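import Mathlib
import Literature.Algebra.Homology.HerbrandQuotientEndomorphisms
import Summits.BirchSwinnertonDyer.BirchSwinnertonDyer.Theorems.ResidualThetaTransportAtTwoSignedMuSeedAtTwoPlusNonsquareDescentFreeness
import HarnessLib

/-!
# Non-square descent — THE HERBRAND INDEX: «units modulo norms have the order of `H¹`» for a lattice containing a free cyclic
# sublattice of finite index (stub S2 residue «`[𝓔_n^χ : 𝒩_n] ≤ #F^χ`» of line `nonsquare-descent`, its Herbrand-quotient half) —
# seed crux `SignedMuSeedAtTwoPlus` stmt-BirchSwinnertonDyer-21438 (parent Kμ⁺ `SignedMuVanishingAtTwoPlus` stmt-BirchSwinnertonDyer-20689,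
# route ResidualThetaTransportAtTwo), line card `Cruxes/SignedMuSeedAtTwoPlus/Lines/nonsquare-descent.md`

Cell `bsd-wall`, width seat `bsd-wall-rtt-p4-w2` g19 (`--supports`, closes nothing).  THEOREMS ONLY; BSD is not proved by this and nothing
arithmetic is asserted: module algebra over a commutative ring, in the index currency `Herbrand.index T S = |T/(S ∩ T)|` of the tree's
`Literature.Algebra.Homology.HerbrandQuotientEndomorphisms` (Neukirch I §6 (6.2), (6.7), (6.8) are there; (6.6) — the Herbrand quotient of a
module equals that of a submodule of FINITE INDEX — is in the tree only for `Rep k G` through Serre's exact hexagon,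
`HerbrandQuotientFiniteKernel`).

Stub S2 of the card bounds `#B'_n` by `#F^χ · #(Q'/ω_nQ')`; after g18's `…NormIndexSplit` (`#B'_n ∣ [𝓔_n^χ : 𝒩_n] · #(Q'/ω_nQ')`) the one
arithmetic factor left is `[𝓔_n^χ : 𝒩_n]` («units modulo universal norms»), whose finite-level pieces are `[𝓔_n^χ : N_{m,n} 𝓔_m^χ] = #Ĥ⁰(G_{m,n}, 𝓔_m^χ)`.
The card: «Herbrand quotient 1 on χ-parts, `H¹(G, E_m) ≅ P_m^G/P_n`, … capitulation `≤ #F^χ`».  THIS FILE discharges «Herbrand quotient 1» as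
module algebra: in the dictionary of g17's `…Freeness` (`R` = `Λ'`, `ω` = `ω_n`, `ν` = `ν_{m,n}`, `E` = `𝓔_m^χ` killed by `ν ω`, `u = u_m` with annihilator
EXACTLY `(ν ω)` = stub S1 «`𝒪[G_m]u_m` free of rank one», `E ⧸ R∙u = B'_m` FINITE = stub S1 «finite index»), the two Tate groups of `G_{m,n} = ⟨γ^{2ⁿ}⟩`
are `Ĥ⁰ = E[ω]/νE` and `H¹ = Ĥ⁻¹ = E[ν]/ωE`, and

  **`[E[ω] : νE] = [E[ν] : ωE]`, both finite** (`index_torsionBy_smul_top_eq`, `index_torsionBy_smul_top_ne_zero`),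

i.e. «`[𝓔_n^χ : N_{m,n}𝓔_m^χ] = #H¹(G_{m,n}, 𝓔_m^χ)`»; in g17's level-`n` presentation `j : En ↪ E` (range `E[ω]`):
`#(En ⧸ j⁻¹(νE)) = [E[ν] : ωE]` (`natCard_quotient_comap_smul_top_eq`).  What it rests on (general, any pair of endomorphisms `f g` with
`fg = gf = 0` and any `f,g`-stable submodule `C` with `M ⧸ C` finite — Serre VIII §4 Cor. to Prop. 8 / Neukirch I §6 (6.6) WITHOUT the hexagon,
by index calculus):

* §1 `index_self` (`(T : T) = 1`), **`index_mul_index`** (tower `(T : T')(T' : T'') = (T : T'')` for `T'' ≤ T' ≤ T`).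
* §2 `index_range_map` (`(fM : fC) = (M : C + ker f)`), `card_quotient_sup_mul_index_ker`, **`index_ker_mul_index_range_map`**
  (`(ker f : C)·(fM : fC) = (M : C)` — any `f`, any `C`).
* §3 **`index_ker_range_mul_eq`**: `h⁰(M) · [(gM : gC)(fM : fC)] = (M : C) · h⁰(C)` where `h⁰(M) = (ker f : gM)`, `h⁰(C) = (C ∩ ker f : gC)`
  (`Nat.card`, unconditional); hence for `(M : C) ≠ 0`: `index_range_map_ne_zero`, **`index_ker_range_ne_zero_iff`** (`h⁰(M)` finite iff `h⁰(C)`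
  finite), **`index_mul_index_eq_of_finite_index`** (`h⁰(M)·h¹(C) = h¹(M)·h⁰(C)`), **`index_ker_range_eq_of_finite_index`** (`h⁰(C) = h¹(C) ⟹
  h⁰(M) = h¹(M)`), `endoQuotient_eq_of_finite_index` (`q_{f,g}(M) = h⁰(C)/h¹(C)`, Neukirch (6.6) for an inclusion of finite index).
* §4 the scalar pair `f = ω•`, `g = ν•` on g17's Freeness data: `lsmul_comp_lsmul_eq_zero`, `ker_lsmul_eq_torsionBy`, `range_lsmul_eq_smul_top`,
  `map_lsmul_span_singleton`, `index_span_norm_eq_one` (both Tate indices of the free cyclic module `R∙u` are `1`: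
  `R∙u ∩ E[ω] = R∙νu = ν(R∙u)`, g17's `span_inf_torsionBy_eq_span_norm`), and the three displayed consequences.

General-purpose (candidate for re-homing next to `HerbrandQuotientEndomorphisms` by a librarian).  [folklore]
-/

set_option autoImplicit false
-- the Theorems namespace of this sub repeats the summit name by design (D-0017 nested layout)
set_option linter.dupNamespace false

open scoped Pointwise nonZeroDivisors
open Literature.Algebra.Homology

namespace Summit.BirchSwinnertonDyer.BirchSwinnertonDyer.Theorems.SignedMuAtTwo.NonsquareDescent

variable {R : Type*} [CommRing R] {M : Type*} [AddCommGroup M] [Module R M]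

/-! ## §1 Index calculus: `(T : T) = 1` and the tower formula -/

/-- `(T : T) = 1`. [folklore] -/
theorem index_self (T : Submodule R M) : Herbrand.index T T = 1 := by
  rw [Herbrand.index_eq_card_map_mkQ, Submodule.mkQ_map_self]
  exact Nat.card_unique

/-- The quotient map `T ⧸ (T'' ∩ T) → M ⧸ T''` induced by the inclusion `T ≤ M` is injective. [folklore] -/
theorem mapQ_comap_subtype_injective (T T'' : Submodule R M) :
    Function.Injective (Submodule.mapQ (T''.comap T.subtype) T'' T.subtype le_rfl) := by
  rw [← LinearMap.ker_eq_bot, Submodule.eq_bot_iff]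
  intro x hx
  obtain ⟨y, rfl⟩ := Submodule.mkQ_surjective _ x
  rw [LinearMap.mem_ker, Submodule.mkQ_apply, Submodule.mapQ_apply, Submodule.Quotient.mk_eq_zero] at hx
  rw [Submodule.mkQ_apply, Submodule.Quotient.mk_eq_zero, Submodule.mem_comap]
  exact hx

/-- **The tower formula `(T : T')·(T' : T'') = (T : T'')` for `T'' ≤ T' ≤ T`** (`Nat.card`, unconditional). [folklore] -/
theorem index_mul_index {T T' T'' : Submodule R M} (h₁ : T'' ≤ T') (h₂ : T' ≤ T) :
    Herbrand.index T T' * Herbrand.index T' T'' = Herbrand.index T T'' := by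
  have hle : T''.comap T.subtype ≤ T'.comap T.subtype := Submodule.comap_mono h₁
  have hmap : ((T'.comap T.subtype).map (T''.comap T.subtype).mkQ).map
      (Submodule.mapQ (T''.comap T.subtype) T'' T.subtype le_rfl) = T'.map T''.mkQ := by
    rw [← Submodule.map_comp, Submodule.mapQ_mkQ, Submodule.map_comp, Submodule.map_comap_subtype,
      inf_eq_right.2 h₂]
  have hcard : Herbrand.index T' T'' = Nat.card ((T'.comap T.subtype).map (T''.comap T.subtype).mkQ) := by
    rw [Herbrand.index_eq_card_map_mkQ, ← hmap]
    exact (Nat.card_congr (Submodule.equivMapOfInjective _ (mapQ_comap_subtype_injective T T'') _).toEquiv).symm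
  rw [hcard, Herbrand.index, Herbrand.index, mul_comm]
  exact Submodule.card_quotient_mul_card_quotient _ _ hle

/-! ## §2 `(ker f : C) · (fM : fC) = (M : C)` for any endomorphism `f` and any submodule `C` -/

section AnyEndo

variable (f : Module.End R M) (C : Submodule R M)

/-- The kernel of `M →ᶠ fM → fM/fC` is `C + ker f`. [folklore] -/
theorem ker_mkQ_comp_rangeRestrict_map :
    LinearMap.ker (((C.map f).comap (LinearMap.range f).subtype).mkQ ∘ₗ f.rangeRestrict) = C ⊔ LinearMap.ker f := by
  ext x
  rw [LinearMap.mem_ker, LinearMap.comp_apply, Submodule.mkQ_apply, Submodule.Quotient.mk_eq_zero,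
    Submodule.mem_comap, Submodule.subtype_apply, LinearMap.codRestrict_apply, Submodule.mem_map, Submodule.mem_sup]
  constructor
  · rintro ⟨c, hc, hcx⟩
    refine ⟨c, hc, x - c, ?_, add_sub_cancel c x⟩
    rw [LinearMap.mem_ker, map_sub, hcx, sub_self]
  · rintro ⟨c, hc, z, hz, rfl⟩
    rw [LinearMap.mem_ker] at hz
    exact ⟨c, hc, by rw [map_add, hz, add_zero]⟩

/-- **`(fM : fC) = (M : C + ker f)`** (`f` induces `M/(C + ker f) ≃ fM/fC`). [folklore] -/
theorem index_range_map :
    Herbrand.index (LinearMap.range f) (C.map f) = Nat.card (M ⧸ (C ⊔ LinearMap.ker f)) := by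
  set ψ := ((C.map f).comap (LinearMap.range f).subtype).mkQ ∘ₗ f.rangeRestrict
  have hψ : Function.Surjective ψ :=
    (Submodule.mkQ_surjective _).comp (LinearMap.surjective_rangeRestrict f)
  rw [Herbrand.index, ← Nat.card_congr (LinearMap.quotKerEquivOfSurjective ψ hψ).toEquiv]
  exact Nat.card_congr (Submodule.quotEquivOfEq _ _ (ker_mkQ_comp_rangeRestrict_map f C)).toEquiv

/-- `(M : ker f + C) · (ker f : C) = (M : C)` (tower and Noether `((ker f + C) : C) = (ker f : C)`). [folklore] -/
theorem card_quotient_sup_mul_index_ker :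
    Nat.card (M ⧸ (LinearMap.ker f ⊔ C)) * Herbrand.index (LinearMap.ker f) C = Nat.card (M ⧸ C) := by
  rw [← Herbrand.index_sup (LinearMap.ker f) C]
  exact (Herbrand.card_quotient_eq_mul_index (le_sup_right : C ≤ LinearMap.ker f ⊔ C)).symm

/-- **`(ker f : C) · (fM : fC) = (M : C)`** — for ANY endomorphism `f` and ANY submodule `C` (`Nat.card`, unconditional: both sides are `0`
exactly when `M ⧸ C` is infinite). [folklore] -/
theorem index_ker_mul_index_range_map :
    Herbrand.index (LinearMap.ker f) C * Herbrand.index (LinearMap.range f) (C.map f) = Nat.card (M ⧸ C) := by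
  rw [index_range_map, sup_comm, mul_comm]
  exact card_quotient_sup_mul_index_ker f C

/-- Hence `(fM : fC) ≠ 0` (i.e. `fM/fC` is finite) as soon as `(M : C) ≠ 0`. [folklore] -/
theorem index_range_map_ne_zero (hC : Nat.card (M ⧸ C) ≠ 0) :
    Herbrand.index (LinearMap.range f) (C.map f) ≠ 0 := by
  intro h
  apply hC
  rw [← index_ker_mul_index_range_map f C, h, mul_zero]

end AnyEndo

/-! ## §3 The Herbrand indices of `M` and of an `f,g`-stable submodule `C` of finite index -/

section FiniteIndex

variable {f g : Module.End R M} {C : Submodule R M}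

/-- **The key identity `h⁰(M) · [(gM : gC)·(fM : fC)] = (M : C) · h⁰(C)`**, where `h⁰(M) = (ker f : gM)` and
`h⁰(C) = (C ∩ ker f : gC)` are the `0`-th Herbrand indices of the pair `(f, g)` on `M` and on the `g`-stable submodule `C`
(`fg = 0`; `Nat.card`, unconditional).  Proof: both `(ker f : gM)(gM : gC)` and `(ker f : C)(C ∩ ker f : gC)` are `(ker f : gC)`
(towers), and `(ker f : C)(fM : fC) = (M : C)` (§2). [folklore] -/
theorem index_ker_range_mul_eq (hfg : f ∘ₗ g = 0) (hgC : C.map g ≤ C) :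
    Herbrand.index (LinearMap.ker f) (LinearMap.range g) *
        (Herbrand.index (LinearMap.range g) (C.map g) * Herbrand.index (LinearMap.range f) (C.map f)) =
      Nat.card (M ⧸ C) * Herbrand.index (C ⊓ LinearMap.ker f) (C.map g) := by
  have hg : LinearMap.range g ≤ LinearMap.ker f := LinearMap.range_le_ker_iff.2 hfg
  have h1 : C.map g ≤ LinearMap.range g := LinearMap.map_le_range
  have h2 : C.map g ≤ C ⊓ LinearMap.ker f := le_inf hgC (h1.trans hg)
  have t1 := index_mul_index h1 hg
  have t2 := index_mul_index h2 (inf_le_right : C ⊓ LinearMap.ker f ≤ LinearMap.ker f)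
  rw [Herbrand.index_inf_right] at t2
  have n := index_ker_mul_index_range_map f C
  calc Herbrand.index (LinearMap.ker f) (LinearMap.range g) *
        (Herbrand.index (LinearMap.range g) (C.map g) * Herbrand.index (LinearMap.range f) (C.map f))
      = (Herbrand.index (LinearMap.ker f) (LinearMap.range g) * Herbrand.index (LinearMap.range g) (C.map g)) *
          Herbrand.index (LinearMap.range f) (C.map f) := by ring
    _ = Herbrand.index (LinearMap.ker f) C * Herbrand.index (C ⊓ LinearMap.ker f) (C.map g) *
          Herbrand.index (LinearMap.range f) (C.map f) := by rw [t1, ← t2]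
    _ = Nat.card (M ⧸ C) * Herbrand.index (C ⊓ LinearMap.ker f) (C.map g) := by rw [← n]; ring

/-- **Finiteness transfer: for `C` of finite index, `h⁰(M) = (ker f : gM)` is finite iff `h⁰(C) = (C ∩ ker f : gC)` is**
(Serre: «if one of `h(A)`, `h(B)` is defined, then so is the other»). [folklore] -/
theorem index_ker_range_ne_zero_iff (hfg : f ∘ₗ g = 0) (hgC : C.map g ≤ C) (hC : Nat.card (M ⧸ C) ≠ 0) :
    Herbrand.index (LinearMap.ker f) (LinearMap.range g) ≠ 0 ↔ Herbrand.index (C ⊓ LinearMap.ker f) (C.map g) ≠ 0 := by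
  have hD : Herbrand.index (LinearMap.range g) (C.map g) * Herbrand.index (LinearMap.range f) (C.map f) ≠ 0 :=
    mul_ne_zero (index_range_map_ne_zero g C hC) (index_range_map_ne_zero f C hC)
  have key := index_ker_range_mul_eq hfg hgC
  constructor
  · intro h h0
    rw [h0, mul_zero] at key
    exact mul_ne_zero h hD key
  · intro h h0
    rw [h0, zero_mul] at key
    exact mul_ne_zero hC h key.symm

/-- **THE COMPARISON `h⁰(M) · h¹(C) = h¹(M) · h⁰(C)`** for a pair of endomorphisms `f, g` with `fg = gf = 0` and an `f,g`-stable submodule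
`C` of FINITE index: `(ker f : gM)·(C ∩ ker g : fC) = (ker g : fM)·(C ∩ ker f : gC)` — Serre VIII §4 Cor. to Prop. 8 / Neukirch I §6 (6.6)
for an inclusion with finite cokernel, by index calculus instead of the exact hexagon. [folklore] -/
theorem index_mul_index_eq_of_finite_index (hfg : f ∘ₗ g = 0) (hgf : g ∘ₗ f = 0) (hfC : C.map f ≤ C) (hgC : C.map g ≤ C)
    (hC : Nat.card (M ⧸ C) ≠ 0) :
    Herbrand.index (LinearMap.ker f) (LinearMap.range g) * Herbrand.index (C ⊓ LinearMap.ker g) (C.map f) =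
      Herbrand.index (LinearMap.ker g) (LinearMap.range f) * Herbrand.index (C ⊓ LinearMap.ker f) (C.map g) := by
  set D := Herbrand.index (LinearMap.range g) (C.map g) * Herbrand.index (LinearMap.range f) (C.map f) with hDdef
  have hD : D ≠ 0 := mul_ne_zero (index_range_map_ne_zero g C hC) (index_range_map_ne_zero f C hC)
  have hA := index_ker_range_mul_eq hfg hgC
  have hB := index_ker_range_mul_eq hgf hfC
  rw [mul_comm (Herbrand.index (LinearMap.range f) (C.map f)), ← hDdef] at hB
  rw [← hDdef] at hA
  apply Nat.eq_of_mul_eq_mul_right (Nat.pos_of_ne_zero (mul_ne_zero hC hD))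
  calc Herbrand.index (LinearMap.ker f) (LinearMap.range g) * Herbrand.index (C ⊓ LinearMap.ker g) (C.map f) *
        (Nat.card (M ⧸ C) * D)
      = (Herbrand.index (LinearMap.ker f) (LinearMap.range g) * D) *
          (Nat.card (M ⧸ C) * Herbrand.index (C ⊓ LinearMap.ker g) (C.map f)) := by ring
    _ = (Nat.card (M ⧸ C) * Herbrand.index (C ⊓ LinearMap.ker f) (C.map g)) *
          (Herbrand.index (LinearMap.ker g) (LinearMap.range f) * D) := by rw [hA, hB]
    _ = Herbrand.index (LinearMap.ker g) (LinearMap.range f) * Herbrand.index (C ⊓ LinearMap.ker f) (C.map g) *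
        (Nat.card (M ⧸ C) * D) := by ring

/-- **`h⁰(C) = h¹(C) ⟹ h⁰(M) = h¹(M)`** for an `f,g`-stable submodule `C` of finite index (in particular when both Tate indices of `C`
are `1`: then `(ker f : gM) = (ker g : fM)`, «`[M^G : N M] = #H¹(G, M)`»). [folklore] -/
theorem index_ker_range_eq_of_finite_index (hfg : f ∘ₗ g = 0) (hgf : g ∘ₗ f = 0) (hfC : C.map f ≤ C) (hgC : C.map g ≤ C)
    (hC : Nat.card (M ⧸ C) ≠ 0)
    (hCeq : Herbrand.index (C ⊓ LinearMap.ker f) (C.map g) = Herbrand.index (C ⊓ LinearMap.ker g) (C.map f)) :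
    Herbrand.index (LinearMap.ker f) (LinearMap.range g) = Herbrand.index (LinearMap.ker g) (LinearMap.range f) := by
  by_cases h0 : Herbrand.index (C ⊓ LinearMap.ker f) (C.map g) = 0
  · have a : Herbrand.index (LinearMap.ker f) (LinearMap.range g) = 0 := by
      by_contra h
      exact (index_ker_range_ne_zero_iff hfg hgC hC).1 h h0
    have b : Herbrand.index (LinearMap.ker g) (LinearMap.range f) = 0 := by
      by_contra h
      exact (index_ker_range_ne_zero_iff hgf hfC hC).1 h (hCeq ▸ h0)
    rw [a, b]
  · have key := index_mul_index_eq_of_finite_index hfg hgf hfC hgC hC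
    rw [← hCeq] at key
    exact Nat.eq_of_mul_eq_mul_right (Nat.pos_of_ne_zero h0) key

/-- **Neukirch I §6 (6.6) for an inclusion of finite index: `q_{f,g}(M) = h⁰(C)/h¹(C)`** (`= q_{f|C, g|C}(C)`), as soon as `h¹(C)` is
finite (then all four indices are finite or the two `h⁰` vanish together). [folklore] -/
theorem endoQuotient_eq_of_finite_index (hfg : f ∘ₗ g = 0) (hgf : g ∘ₗ f = 0) (hfC : C.map f ≤ C) (hgC : C.map g ≤ C)
    (hC : Nat.card (M ⧸ C) ≠ 0) (h1C : Herbrand.index (C ⊓ LinearMap.ker g) (C.map f) ≠ 0) :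
    Herbrand.endoQuotient f g =
      (Herbrand.index (C ⊓ LinearMap.ker f) (C.map g) : ℚ) / (Herbrand.index (C ⊓ LinearMap.ker g) (C.map f) : ℚ) := by
  have h1M : Herbrand.index (LinearMap.ker g) (LinearMap.range f) ≠ 0 :=
    (index_ker_range_ne_zero_iff hgf hfC hC).2 h1C
  have key := index_mul_index_eq_of_finite_index hfg hgf hfC hgC hC
  rw [mul_comm (Herbrand.index (LinearMap.ker g) (LinearMap.range f))] at key
  rw [Herbrand.endoQuotient_def, div_eq_div_iff (Nat.cast_ne_zero.2 h1M) (Nat.cast_ne_zero.2 h1C)]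
  exact_mod_cast key

end FiniteIndex

/-! ## §4 The scalar pair `(ω•, ν•)` on g17's Freeness data: `[E[ω] : νE] = [E[ν] : ωE]`, finite -/

section Scalar

variable {E : Type*} [AddCommGroup E] [Module R E]

/-- `(ω•) ∘ (ν•) = 0` on a module killed by `ν ω`. [folklore] -/
theorem lsmul_comp_lsmul_eq_zero {ν ω : R} (hE : ∀ x : E, (ν * ω) • x = 0) :
    DistribSMul.toLinearMap R E ω ∘ₗ DistribSMul.toLinearMap R E ν = 0 := by
  ext x
  rw [LinearMap.comp_apply, DistribSMul.toLinearMap_apply, DistribSMul.toLinearMap_apply, smul_smul, mul_comm, hE,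
    LinearMap.zero_apply]

/-- `ker (ω•) = E[ω]`. [folklore] -/
theorem ker_lsmul_eq_torsionBy (ω : R) :
    LinearMap.ker (DistribSMul.toLinearMap R E ω) = Submodule.torsionBy R E ω := rfl

/-- `im (ω•) = ωE`. [folklore] -/
theorem range_lsmul_eq_smul_top (ω : R) :
    LinearMap.range (DistribSMul.toLinearMap R E ω) = ω • (⊤ : Submodule R E) := by
  rw [LinearMap.range_eq_map]
  rfl

/-- `(ω•)(C) = ω • C`. [folklore] -/
theorem map_lsmul_eq_smul (ω : R) (C : Submodule R E) :
    C.map (DistribSMul.toLinearMap R E ω) = ω • C := rfl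

/-- `(ν•)(R∙u) = R∙(ν • u)`. [folklore] -/
theorem map_lsmul_span_singleton (ν : R) (u : E) :
    (Submodule.span R {u}).map (DistribSMul.toLinearMap R E ν) = Submodule.span R {ν • u} := by
  rw [Submodule.map_span, Set.image_singleton, DistribSMul.toLinearMap_apply]

/-- **Both Tate indices of the free cyclic module are `1`**: `(R∙u ∩ E[ω] : ν(R∙u)) = 1` when the annihilator of `u` is exactly `(ν ω)`
and `ω` is a non-zero-divisor (g17: `R∙u ∩ E[ω] = R∙(ν • u)` — «`(𝒪[G_m]u)^G = 𝒪[G_n]·N u`, `Ĥ⁰(G, free) = 0`»). [folklore] -/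
theorem index_span_norm_eq_one {ν ω : R} (hω : ω ∈ R⁰) {u : E} (hu0 : (ν * ω) • u = 0)
    (hu : ∀ r : R, r • u = 0 → ν * ω ∣ r) :
    Herbrand.index (Submodule.span R {u} ⊓ LinearMap.ker (DistribSMul.toLinearMap R E ω))
      ((Submodule.span R {u}).map (DistribSMul.toLinearMap R E ν)) = 1 := by
  rw [ker_lsmul_eq_torsionBy, span_inf_torsionBy_eq_span_norm hω hu0 hu, map_lsmul_span_singleton]
  exact index_self _

/-- The hypothesis «annihilator of `u` is exactly `(ν ω)`» with the factors swapped. [folklore] -/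
theorem ann_swap {ν ω : R} {u : E} (hu : ∀ r : R, r • u = 0 → ν * ω ∣ r) :
    ∀ r : R, r • u = 0 → ω * ν ∣ r := fun r hr => mul_comm ν ω ▸ hu r hr

/-- **THE HERBRAND INDEX IDENTITY `[E[ω] : νE] = [E[ν] : ωE]`** — «`[𝓔_n^χ : N_{m,n} 𝓔_m^χ] = #H¹(G_{m,n}, 𝓔_m^χ)`, Herbrand quotient `1`»:
for `E` killed by `ν ω` (`ω`, `ν` non-zero-divisors) containing `u` with annihilator EXACTLY `(ν ω)` (S1: `𝒪[G_m]u_m` free) such that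
`E ⧸ R∙u` is FINITE (S1: finite index), the index of the norms `νE` in the invariants `E[ω]` equals the index of `ωE` in the norm-kernel
`E[ν]`. [folklore] -/
theorem index_torsionBy_smul_top_eq {ν ω : R} (hω : ω ∈ R⁰) (hν : ν ∈ R⁰) (hE : ∀ x : E, (ν * ω) • x = 0) {u : E}
    (hu : ∀ r : R, r • u = 0 → ν * ω ∣ r) [Finite (E ⧸ Submodule.span R {u})] :
    Herbrand.index (Submodule.torsionBy R E ω) (ν • (⊤ : Submodule R E)) =
      Herbrand.index (Submodule.torsionBy R E ν) (ω • (⊤ : Submodule R E)) := by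
  have hE' : ∀ x : E, (ω * ν) • x = 0 := fun x => mul_comm ν ω ▸ hE x
  rw [← ker_lsmul_eq_torsionBy, ← ker_lsmul_eq_torsionBy, ← range_lsmul_eq_smul_top, ← range_lsmul_eq_smul_top]
  refine index_ker_range_eq_of_finite_index (C := Submodule.span R {u}) (lsmul_comp_lsmul_eq_zero hE)
    (lsmul_comp_lsmul_eq_zero hE') ?_ ?_ Nat.card_pos.ne' ?_
  · rw [map_lsmul_span_singleton]; exact span_norm_le_span u
  · rw [map_lsmul_span_singleton]; exact span_norm_le_span u
  · rw [index_span_norm_eq_one hω (hE u) hu, index_span_norm_eq_one hν (hE' u) (ann_swap hu)]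

/-- **… and both are FINITE** (`(E[ω] : νE) ≠ 0`): «`𝓔_n^χ / N_{m,n}𝓔_m^χ` is finite». [folklore] -/
theorem index_torsionBy_smul_top_ne_zero {ν ω : R} (hω : ω ∈ R⁰) (hE : ∀ x : E, (ν * ω) • x = 0) {u : E}
    (hu : ∀ r : R, r • u = 0 → ν * ω ∣ r) [Finite (E ⧸ Submodule.span R {u})] :
    Herbrand.index (Submodule.torsionBy R E ω) (ν • (⊤ : Submodule R E)) ≠ 0 := by
  rw [← ker_lsmul_eq_torsionBy, ← range_lsmul_eq_smul_top]
  refine (index_ker_range_ne_zero_iff (C := Submodule.span R {u}) (lsmul_comp_lsmul_eq_zero hE) ?_ Nat.card_pos.ne').2 ?_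
  · rw [map_lsmul_span_singleton]; exact span_norm_le_span u
  · rw [index_span_norm_eq_one hω (hE u) hu]; exact one_ne_zero

/-- `#H¹` is finite too: `(E[ν] : ωE) ≠ 0`. [folklore] -/
theorem index_torsionBy_smul_top_ne_zero' {ν ω : R} (hω : ω ∈ R⁰) (hν : ν ∈ R⁰) (hE : ∀ x : E, (ν * ω) • x = 0) {u : E}
    (hu : ∀ r : R, r • u = 0 → ν * ω ∣ r) [Finite (E ⧸ Submodule.span R {u})] :
    Herbrand.index (Submodule.torsionBy R E ν) (ω • (⊤ : Submodule R E)) ≠ 0 := by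
  rw [← index_torsionBy_smul_top_eq hω hν hE hu]
  exact index_torsionBy_smul_top_ne_zero hω hE hu

/-- Reading of the two indices as orders of quotients: `(E[ω] : νE) = #(E[ω] ⧸ (νE ∩ E[ω]))` = `#(E^G/N_G E)` = `#Ĥ⁰(G, E)` and
`(E[ν] : ωE) = #(_N E / I_G E)` = `#H¹(G, E)` for `G = ⟨σ⟩` cyclic acting through `ω = σ − 1`, `ν = 1 + σ + ⋯ + σ^{|G|-1}`. [folklore] -/
theorem index_torsionBy_smul_top_def (ω ν : R) :
    Herbrand.index (Submodule.torsionBy R E ω) (ν • (⊤ : Submodule R E)) =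
      Nat.card (↥(Submodule.torsionBy R E ω) ⧸ (ν • (⊤ : Submodule R E)).comap (Submodule.torsionBy R E ω).subtype) := rfl

end Scalar

/-! ## §5 The level-`n` presentation `j : En ↪ E` with range `E[ω]`: `#(En ⧸ j⁻¹(νE)) = #H¹` -/

section LevelN

variable {E : Type*} [AddCommGroup E] [Module R E] {En : Type*} [AddCommGroup En] [Module R En]

/-- g17's two hypotheses `hjω`, `hjr` say `range j = E[ω]`. [folklore] -/
theorem range_eq_torsionBy_of {ω : R} (j : En →ₗ[R] E) (hjω : ∀ x : En, ω • j x = 0)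
    (hjr : ∀ e : E, ω • e = 0 → e ∈ LinearMap.range j) : LinearMap.range j = Submodule.torsionBy R E ω := by
  ext e
  rw [Submodule.mem_torsionBy_iff]
  constructor
  · rintro ⟨x, rfl⟩; exact hjω x
  · exact hjr e

/-- Transport of an index along a linear map: `#(En ⧸ j⁻¹ S) = (range j : S)` (`j(En)/(S ∩ j(En)) ≃ En/j⁻¹S`). [folklore] -/
theorem natCard_quotient_comap_eq_index (j : En →ₗ[R] E) (S : Submodule R E) :
    Nat.card (En ⧸ S.comap j) = Herbrand.index (LinearMap.range j) S := by
  have hker : LinearMap.ker (S.mkQ ∘ₗ j) = S.comap j := by rw [LinearMap.ker_comp, Submodule.ker_mkQ]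
  have hrange : LinearMap.range (S.mkQ ∘ₗ j) = (LinearMap.range j).map S.mkQ := LinearMap.range_comp _ _
  rw [Herbrand.index_eq_card_map_mkQ, ← hrange, ← Nat.card_congr (LinearMap.quotKerEquivRange (S.mkQ ∘ₗ j)).toEquiv,
    hker]

/-- **`#(En ⧸ j⁻¹(νE)) = (E[ν] : ωE)`, finite** — in g17's level-`n` presentation (`j : En → E` with range the `ω`-torsion, `E` killed by
`ν ω`, `u ∈ E` with annihilator exactly `(ν ω)`, `E ⧸ R∙u` finite): «`[𝓔_n^χ : N_{m,n}𝓔_m^χ] = #H¹(G_{m,n}, 𝓔_m^χ)`». [folklore] -/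
theorem natCard_quotient_comap_smul_top_eq {ν ω : R} (hω : ω ∈ R⁰) (hν : ν ∈ R⁰) (hE : ∀ x : E, (ν * ω) • x = 0) {u : E}
    (hu : ∀ r : R, r • u = 0 → ν * ω ∣ r) [Finite (E ⧸ Submodule.span R {u})]
    (j : En →ₗ[R] E) (hjω : ∀ x : En, ω • j x = 0) (hjr : ∀ e : E, ω • e = 0 → e ∈ LinearMap.range j) :
    Nat.card (En ⧸ (ν • (⊤ : Submodule R E)).comap j) =
      Herbrand.index (Submodule.torsionBy R E ν) (ω • (⊤ : Submodule R E)) := by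
  rw [natCard_quotient_comap_eq_index j, range_eq_torsionBy_of j hjω hjr]
  exact index_torsionBy_smul_top_eq hω hν hE hu

/-- … and `En ⧸ j⁻¹(νE)` is finite. [folklore] -/
theorem finite_quotient_comap_smul_top {ν ω : R} (hω : ω ∈ R⁰) (hE : ∀ x : E, (ν * ω) • x = 0) {u : E}
    (hu : ∀ r : R, r • u = 0 → ν * ω ∣ r) [Finite (E ⧸ Submodule.span R {u})]
    (j : En →ₗ[R] E) (hjω : ∀ x : En, ω • j x = 0) (hjr : ∀ e : E, ω • e = 0 → e ∈ LinearMap.range j) :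
    Finite (En ⧸ (ν • (⊤ : Submodule R E)).comap j) := by
  refine Nat.finite_of_card_ne_zero ?_
  rw [natCard_quotient_comap_eq_index j, range_eq_torsionBy_of j hjω hjr]
  exact index_torsionBy_smul_top_ne_zero hω hE hu

end LevelN

end Summit.BirchSwinnertonDyer.BirchSwinnertonDyer.Theorems.SignedMuAtTwo.NonsquareDescent
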